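import Literature.MathematicalPhysics.QuantumFieldTheory.Balaban1983to89.B8Claim97KLevel
import Literature.MathematicalPhysics.QuantumFieldTheory.Balaban1983to89.B8Eq1124Local

/-!
# `Balaban1983to89.B8DprimeKLevelAnalytic` — [Balaban1985RegularSpaces] Sect. E p. 97 «This solution is an analytic function of λ» AT `k`
# LEVELS, HONEST PARTIAL READING: through the explicit inverse `λ = λ′ + H′C′(λ′)` of (1.113) (`B8Claim97KLevel`), the solution is
# `D′(λ) = C′(λ′)`, and each of its components `C′_j(u₁, λ′)(y)`, `y ∈ Λ_j`, is analytic along every sitewise-analytic family `λ′(t)`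
# (dag-n04-b's tower-local (208)/(1.124), `B8Eq1124Local.analyticAt_Cnl_local`) — analyticity IN THE VARIABLE `λ′` of (1.113)'s image

statement-level skeleton of published theorems with citation tags; proofs where landed; nothing here is a claim about the Yang–Mills mass gap

T. Bałaban, *Spaces of regular gauge field configurations on a lattice and gauge fixing conditions*, Commun.
Math. Phys. **99** (1985) 75–102 `[Balaban1985RegularSpaces]` ("B8"), p. 97 [PDF 23]; [3] = [Balaban1985Averaging] (208) p. 50.  STATUS:
published, refereed.

CITATION HEADER (lean-in-tree rule).  Cell `pub-ymgap` (YM Track A, DAG node N05 = [B8]), seat `pub-ymgap-dag-n05-b`, gen 0; dag-lead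
[REBALANCE-26] closer (a).  WHAT IS REPRODUCED = the p. 97 sentence «This solution is an analytic function of λ defined on the set of λ
satisfying (1.119)» in the PART the tree can state at `k` levels without a Banach λ-space: with `X₀ = C′(λ′)|_{𝔅_k}` and `λ = λ′ + H′X₀`
(`B8Claim97KLevel.exists_masked_Cnl` / `onto_kLevel`: `X₀` solves (1.117) for `λ`, so `X₀ = D′(λ)` by «exactly one solution»), the map
`λ′ ↦ D′(λ(λ′)) = C′(λ′)` is COMPONENTWISE analytic along sitewise-analytic families `t ↦ λ′(t)` — this is dag-n04-b's
`B8Eq1124Local.analyticAt_Cnl_local` (the tower-local (208) of [3]) read at the top of each tower, for an arbitrary `u₁` agreeing with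
`glev_j` on `Bʲ(y)`, in this seat's `c`-letters ((1.69) as `|B_b| ≤ cL^{−j}`).  Kind «kernel-checked proof», theorems only: no `def`, no
`… : Prop` fact, no existing module modified.  REUSED BY NAME: `B8Eq1124Local.analyticAt_Cnl_local`, `B8Eq1117KLevel.Cnl_congr_u1_tower`,
`B8Eq1117KLevel.glev_on_towers_of_axial`.

## WHAT IS CERTIFIED HERE (kernel; axioms `propext` / `Classical.choice` / `Quot.sound`)

* **`analyticAt_Dprime_via_inverse`** — at a point `(j, y ∈ Λ_j)` of `𝔅_k`, under the tower-local hypotheses ((1.33) on `Bʲ(y)`, (1.69)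
  `|B_b| ≤ cL^{−j}`, `u₁ = glev_j` on `Bʲ(y)`, the `j`-free smallness of `B8Eq1124Local`) and for a family `λ′ : E → (ℤᵈ → 𝔸)` sitewise analytic
  at `t₀` on `Bʲ(y)` with `λ′(t₀)` in the full-size set (1.120) there: `t ↦ C′_j(u₁, λ′(t))(y)` — the `(j, y)`-component of
  `D′(λ′(t) + H′C′(λ′(t)))` — is analytic at `t₀`; **`analyticAt_Dprime_via_inverse_of_axial`** — the same with `u₁ = glev_j` discharged from
  `InAx`/`Restr129`, at every point of `𝔅_k`.

## HONEST SCOPE — what is NOT claimed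

(i) This is analyticity in the IMAGE variable `λ′` of (1.113), componentwise and along sitewise-analytic families (the tree's reading of
«analytic», `B8Eq1123Concrete` READING (d)); print's sentence is analyticity of `D′` in `λ` itself on the set (1.119), which needs the
implicit-function / Banach-λ-space step (`B8Eq1117Analytic` abstractly; a `k`-level λ-space = definition lane) — NOT here.  (ii) That
`C′(λ′(t))|_{𝔅_k} = D′(λ(t))` for `λ(t) = λ′(t) + H′C′(λ′(t))|_{𝔅_k}` is `B8Claim97KLevel.onto_kLevel` (fixed `t`); no uniformity in `t` is
claimed.  Nothing here is progress on the summit.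
-/

noncomputable section

open NormedSpace Finset

namespace Literature.MathematicalPhysics.QuantumFieldTheory.Balaban1983to89.B8DprimeKLevelAnalytic

open B7Prop1Explicit B7Prop2Explicit B7Prop3Flat B7Prop1Local B7Eq167Flat B7Eq167General
open B7Eq170Flat (cj cj_apply)
open B7Prop10General (C6 C4G)
open B7Prop9Flat (C5')
open B7Eq214General (Cgen)
open B8Ineq130 (tlo thi tlo_zero thi_zero)
open B7Eq84Concrete (glev)
open B7Eq92Concrete (mgauge)
open B8Eq119TwistedAxial (InAx Restr129)
open B8Eq1123Concrete (Cnl)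
open B8Eq1117KLevel (Cnl_congr_u1_tower glev_on_towers_of_axial)
open B8Eq1124Local (analyticAt_Cnl_local)

-- `Site` alone could resolve to the torus sites of `Setup.lean`; re-export the `ℤ^d` sites of `B7Prop1Explicit`.
export B7Prop1Explicit (Site)

variable {d : ℕ}

variable {𝔸 : Type*} [NormedRing 𝔸] [NormOneClass 𝔸] [NormedAlgebra ℂ 𝔸] [CompleteSpace 𝔸]
variable {E : Type*} [NormedAddCommGroup E] [NormedSpace ℂ E]
variable {L : ℕ} {G : Subgroup 𝔸ˣ} {j : ℕ} {y : Site d} {U₀ : Site d → Fin d → 𝔸ˣ} {α₀ α₄ c : ℝ} {B : Site d → Fin d → 𝔸}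
  {u₁ : Site d → 𝔸ˣ} {lam' : E → Site d → 𝔸} {t₀ : E}

/-- **THE COMPONENTS OF `D′` THROUGH THE INVERSE OF (1.113) ARE ANALYTIC IN `λ′`** (p. 97 «analytic function of λ», partial reading):
at a point `(j, y)` of `𝔅_k`, for an arbitrary `u₁` with `u₁ = glev_j` on `Bʲ(y)` and a family `λ′(t)` sitewise analytic at `t₀` on
`Bʲ(y)` whose member `λ′(t₀)` lies in the full-size set (1.120) there, the function `t ↦ C′_j(u₁, λ′(t))(y)` (= the `(j, y)`-component of
`D′(λ′(t) + H′C′(λ′(t)))`, `B8Claim97KLevel.onto_kLevel`) is analytic at `t₀`.  (dag-n04-b's tower-local (208), read at the top of the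
tower with (1.69) in the `c`-letters.) [cite: Balaban1985RegularSpaces, p.97 («analytic function of λ»), (1.116)–(1.117) p.96, (1.124) p.97; Balaban1985Averaging, (208) p.50] -/
theorem analyticAt_Dprime_via_inverse (hL : 2 ≤ L) (hG : AvgClosed d L G) (hU₀ : ∀ x κ, U₀ x κ ∈ G)
    (hα : 0 < α₀) (hα3 : C0 d * α₀ ≤ 1 / 3) (hα4 : 4 * α₀ ≤ c2' d L)
    (h33 : pdevOn (tlo L y j) (thi L y j) U₀ < α₀ * (((L : ℝ) ^ j)⁻¹) ^ 2) (hc : 0 ≤ c)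
    (h69 : ∀ (x : Site d) (κ : Fin d), InBox (tlo L y j) (thi L y j) x → InBox (tlo L y j) (thi L y j) (x + e κ) →
      ‖B x κ‖ ≤ c * ((L : ℝ) ^ j)⁻¹)
    (hsmall : Real.exp (4 * (800 * ((d : ℝ) + 1) ^ 2 * ((d : ℝ) + 4)) * α₀) * (1 + 8 * (131072 * ((d : ℝ) + 1) ^ 2) * c) ≤ 2)
    (hc₃ : 2 * c ≤ c3 d L) (hs : 128 * (d : ℝ) * c ≤ 1) (hL1 : 1 ≤ L)
    (hu₁ : ∀ x : Site d, tlo L y j ≤ x → x ≤ thi L y j → u₁ x = glev L hL1 U₀ (expCfg B) j 0 x)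
    (hlam : ∀ x : Site d, InBox (tlo L y j) (thi L y j) x → AnalyticAt ℂ (fun t => lam' t x) t₀)
    (hα₄ : 0 < α₄) (hb : ∀ x : Site d, InBox (tlo L y j) (thi L y j) x → ‖lam' t₀ x‖ < α₄)
    (ha : ∀ (x : Site d) (κ : Fin d), InBox (tlo L y j) (thi L y j) x → InBox (tlo L y j) (thi L y j) (x + e κ) →
      ‖cj (U₀ x κ) (lam' t₀ (x + e κ)) - lam' t₀ x‖ < α₄ * ((L : ℝ) ^ j)⁻¹)
    (hα₃' : 40 * d * c ≤ 1 / 50) (hs₁ : 40 * C6 d * α₄ ≤ 1) (hs₂ : 12000 * ((d : ℝ) + 1) * L * α₄ ≤ 1)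
    (hs₃ : C4G d L * (α₀ + 40 * d * c + 4 * α₄) ≤ 1)
    (hs₄ : 1024 * ((d : ℝ) + 1) * ((d : ℝ) + 4) * L ^ 2 * α₀ ≤ 1) (hs₅ : 32 * ((d : ℝ) + 1) ^ 2 * C6 d * L ^ 2 * α₀ ≤ 1)
    (hs₆ : 16 * d * C5' d * C6 d * (L : ℝ) ^ 2 * α₀ ≤ 1) :
    AnalyticAt ℂ (fun t => Cnl L U₀ u₁ j (lam' t) y) t₀ := by
  have hy : tlo L y 0 ≤ y := by rw [tlo_zero]
  have hy' : y ≤ thi L y 0 := by rw [thi_zero]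
  -- (1.69) in `B8Eq1124Local`'s letters: `|B_b| ≤ b`, `b = c·L^{−j}`, `Lʲb = c`
  have hLj : (0 : ℝ) < (L : ℝ) ^ j := by positivity
  have hkey : (L : ℝ) ^ j * (c * ((L : ℝ) ^ j)⁻¹) = c := by field_simp
  have hbn : 0 ≤ c * ((L : ℝ) ^ j)⁻¹ := by positivity
  -- replace `u₁` by `glev_j` on the tower
  have heq : (fun t => Cnl L U₀ u₁ j (lam' t) y) = fun t => Cnl L U₀ (glev L hL1 U₀ (expCfg B) j 0) j (lam' t) y := by
    funext t
    exact Cnl_congr_u1_tower hL1 hu₁ (lam' t) (m' := j) (n := 0) (by omega) y hy hy'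
  rw [heq]
  exact analyticAt_Cnl_local hL hG hU₀ hα hα3 hα4 h33 hbn h69 (by rw [hkey]; exact hsmall) (by rw [hkey]; exact hc₃)
    (by rw [hkey]; exact hs) hL1 hlam hα₄ hb ha (by rw [hkey]; exact hα₃') hs₁ hs₂ (by rw [hkey]; exact hs₃) hs₄ hs₅ hs₆
    (m := j) (n := 0) (by omega) y hy hy'

/-- **… AT EVERY POINT OF `𝔅_k`, FOR THE INDUCTIVE `u₁`** (`u₁ = glev_j on Bʲ(Λ_j)` from `InAx`/`Restr129`): with the tower-local hypotheses
quantified over `(j, y ∈ Λ_j)`, `j ≤ k`, every component `t ↦ C′_j(u₁, λ′(t))(y)` of `D′` through the inverse of (1.113) is analytic at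
`t₀`. [cite: Balaban1985RegularSpaces, p.97 («analytic function of λ»), (1.19) p.79, (1.29) p.81] -/
theorem analyticAt_Dprime_via_inverse_of_axial (hL : 2 ≤ L) (hL1 : 1 ≤ L) (hG : AvgClosed d L G) (hU₀ : ∀ x κ, U₀ x κ ∈ G)
    {k : ℕ} (Λ : ℕ → Set (Site d))
    (hα : 0 < α₀) (hα3 : C0 d * α₀ ≤ 1 / 3) (hα4 : 4 * α₀ ≤ c2' d L) (hc : 0 ≤ c) (hα₄ : 0 < α₄)
    (h33 : ∀ j, j ≤ k → ∀ y ∈ Λ j, pdevOn (tlo L y j) (thi L y j) U₀ < α₀ * (((L : ℝ) ^ j)⁻¹) ^ 2)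
    (h69 : ∀ j, j ≤ k → ∀ y ∈ Λ j, ∀ (x : Site d) (κ : Fin d), InBox (tlo L y j) (thi L y j) x →
      InBox (tlo L y j) (thi L y j) (x + e κ) → ‖B x κ‖ ≤ c * ((L : ℝ) ^ j)⁻¹)
    (hAx : InAx L k Λ U₀ (mgauge U₀ u₁ (expCfg B) * U₀)) (h129 : Restr129 L k Λ U₀ u₁)
    (hlam : ∀ j, j ≤ k → ∀ y ∈ Λ j, ∀ x : Site d, InBox (tlo L y j) (thi L y j) x → AnalyticAt ℂ (fun t => lam' t x) t₀)
    (hb : ∀ j, j ≤ k → ∀ y ∈ Λ j, ∀ x : Site d, InBox (tlo L y j) (thi L y j) x → ‖lam' t₀ x‖ < α₄)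
    (ha : ∀ j, j ≤ k → ∀ y ∈ Λ j, ∀ (x : Site d) (κ : Fin d), InBox (tlo L y j) (thi L y j) x →
      InBox (tlo L y j) (thi L y j) (x + e κ) → ‖cj (U₀ x κ) (lam' t₀ (x + e κ)) - lam' t₀ x‖ < α₄ * ((L : ℝ) ^ j)⁻¹)
    (hsmall : Real.exp (4 * (800 * ((d : ℝ) + 1) ^ 2 * ((d : ℝ) + 4)) * α₀) * (1 + 8 * (131072 * ((d : ℝ) + 1) ^ 2) * c) ≤ 2)
    (hc₃ : 2 * c ≤ c3 d L) (hs : 128 * (d : ℝ) * c ≤ 1) (hα₃' : 40 * d * c ≤ 1 / 50)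
    (hs₁ : 40 * C6 d * α₄ ≤ 1) (hs₂ : 12000 * ((d : ℝ) + 1) * L * α₄ ≤ 1)
    (hs₃ : C4G d L * (α₀ + 40 * d * c + 4 * α₄) ≤ 1)
    (hs₄ : 1024 * ((d : ℝ) + 1) * ((d : ℝ) + 4) * L ^ 2 * α₀ ≤ 1) (hs₅ : 32 * ((d : ℝ) + 1) ^ 2 * C6 d * L ^ 2 * α₀ ≤ 1)
    (hs₆ : 16 * d * C5' d * C6 d * (L : ℝ) ^ 2 * α₀ ≤ 1) :
    ∀ j, j ≤ k → ∀ y ∈ Λ j, AnalyticAt ℂ (fun t => Cnl L U₀ u₁ j (lam' t) y) t₀ :=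
  fun j hj y hy =>
    analyticAt_Dprime_via_inverse hL hG hU₀ hα hα3 hα4 (h33 j hj y hy) hc (h69 j hj y hy) hsmall hc₃ hs hL1
      (glev_on_towers_of_axial hL1 Λ hAx h129 j hj y hy) (hlam j hj y hy) hα₄ (hb j hj y hy) (ha j hj y hy) hα₃' hs₁ hs₂ hs₃ hs₄
      hs₅ hs₆

#print axioms analyticAt_Dprime_via_inverse
#print axioms analyticAt_Dprime_via_inverse_of_axial

end Literature.MathematicalPhysics.QuantumFieldTheory.Balaban1983to89.B8DprimeKLevelAnalytic

end
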